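import Literature.Computability.QuantumComplexity.CWrapKernel
import Literature.Computability.QuantumComplexity.CWrapAssembly
import HarnessLib

/-!
# Classical wrapping inside quantum search, relative to an oracle: the kernel bound with oracle gates

Theorems-only companion of `CWrapKernel.lean` (file IV of the construction discharging
`Literature.Computability.Cryptography.isQSolvable_classicalWrap`, assembled in `CWrapAssembly.lean`).
There the kernel bound `CWrap.kernelProb_family_ge` — on input `x` the wrapped family
`CWrap.family P` outputs a string with prefix `g ⟨x, y⟩`, `y ∈ R (h x)`, with probability at
least `F.kernelProb 0 (h x) (R (h x))` — is stated for the EMPTY oracle, although every stage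
lemma of files III–IV (`toMatrix_stage1_mulVec_pad`, `toMatrix_stageQ`,
`toMatrix_stage2_mulVec_basisState`, `toReal_outputPMF_map_ofFn`,
`toMatrix_flatMap_mapWires_mulVec_prodState`) holds relative to an arbitrary oracle language `A`:
the classical stages are compiled from `NOT`/`CNOT`/Toffoli words (oracle-free, so their matrices
do not depend on `A`), and the copies of the given family `F.circ ℓ` are placed VERBATIM on their
blocks, oracle gates included (`mapWires` transports query gates to query gates,
`toMatrix_mapWires`). This file records the relativized statements:

* `CWrap.stageQ_mulVec_W1_rel`, `CWrap.runOn_circ_rel`, `CWrap.normSq_blockState_rel` — the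
  product structure of the state after the quantum stage and the final state, relative to `A`
  (the block states are `(Cpad P x ℓ).toMatrix A |block ℓ of w1 x⟩`);
* **`CWrap.kernelProb_family_ge_rel`** — for every oracle language `A`:
  `F.kernelProb A (h x) (R (h x)) ≤ (family P).kernelProb A x {z | ∃ y ∈ R (h x), g ⟨x, y⟩ <+: z}`
  (the proof of `kernelProb_family_ge` verbatim with `A` for `0`);
* **`exists_uniform_classicalWrap_rel`** — the relativized classical wrap in kernel form: for
  `h, g ∈ FP` and a poly-time uniform Clifford+T family `F` WITH ORACLE GATES there is a poly-time
  uniform family `F'` such that, for every oracle `A`, input `x` and event `R`,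
  `F.kernelProb A (h x) R ≤ F'.kernelProb A x {z | ∃ y ∈ R, g ⟨x, y⟩ <+: z}` (parameters from
  `CWrap.exists_params`, uniformity from `CWrap.family_isUniform`, which never assumed
  oracle-freeness); and its search-problem reading `isQSolvableRel_classicalWrap`
  (`IsQSolvableRel A`, `Cryptography/ClassBQP.lean`), the relativization of
  `isQSolvable_classicalWrap_holds`.

This is the circuit half of "deterministic polynomial-time computation is free inside `BQP^A`"
(Bernstein–Vazirani 1997, §8 with §8.3: oracle machines compose with classical subroutines
exactly as oracle-free ones). Consumer: the sampling-to-language bridge of Aaronson–Chen 2017,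
Thm. 8.1 (`Literature/Barriers/QuantumAdvantage/PPolyOraclesSampToLanguage.lean`), where a `BQP^A`
family fed `|x⟩` must be presented as a `SampBQP^A` algorithm fed `|⟨x, 1^k⟩⟩` (`h = fstF`).

## References

* E. Bernstein, U. Vazirani, *Quantum complexity theory*, SIAM J. Comput. 26 (1997), §8
  (classical computation inside quantum machines) and §8.3 (oracle quantum machines)
  [BernsteinVazirani1997].
* M. A. Nielsen, I. L. Chuang, *Quantum Computation and Quantum Information*, CUP 2010, §2.2.5
  (Born rule), §4.3, §4.4 (deferred measurement) [NielsenChuang2010].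
-/

noncomputable section

namespace Literature.Computability.QuantumComplexity

namespace CWrap

open _root_.Computability Complexity Complexity.FinTM2Sim Turing Function RevSim RevClean Cryptography RevMux Matrix
open scoped BigOperators

variable (P : Params) (x : List Bool) (A : Language Bool)

/-! ### The stages relative to an oracle -/

/-- **The state after the quantum stage is the product of the block states, relative to `A`**
(block `ℓ` carries `(Cpad P x ℓ).toMatrix A` applied to its part of `|w1 x⟩`).
[cite: NielsenChuang2010, §2.1.7 eq. (2.45)] -/
theorem stageQ_mulVec_W1_rel :
    (⟨stageQ P x.length⟩ : QCircuit cliffordT (x.length + anc P x.length)).toMatrix A *ᵥ basisState (W1 P x) =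
      prodState (blockEmb P x) (fun ℓ => (Cpad P x ℓ).toMatrix A *ᵥ basisState (W1 P x ∘ blockEmb P x ℓ)) (W1 P x) := by
  rw [toMatrix_stageQ, basisState_eq_prodState (blockEmb P x) (W1 P x),
    toMatrix_flatMap_mapWires_mulVec_prodState A (blockDisjoint P x)]

/-- **The final state relative to `A`**: stage 2 applied to the product of the block states.
[folklore] -/
theorem runOn_circ_rel :
    (circ P x.length).runOn A (basisState (padInput x.get (anc P x.length))) =
      (⟨stage2 P x.length⟩ : QCircuit cliffordT (x.length + anc P x.length)).toMatrix A *ᵥ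
        prodState (blockEmb P x) (fun ℓ => (Cpad P x ℓ).toMatrix A *ᵥ basisState (W1 P x ∘ blockEmb P x ℓ)) (W1 P x) := by
  rw [QCircuit.runOn, circ, show (⟨stage1 P x.length ++ (stageQ P x.length ++ stage2 P x.length)⟩ :
      QCircuit cliffordT (x.length + anc P x.length)) =
      (⟨stage1 P x.length⟩ : QCircuit cliffordT _).append ((⟨stageQ P x.length⟩ : QCircuit cliffordT _).append ⟨stage2 P x.length⟩)
      from rfl, QCircuit.toMatrix_append, QCircuit.toMatrix_append, ← Matrix.mulVec_mulVec, ← Matrix.mulVec_mulVec,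
    toMatrix_stage1_mulVec_pad, stageQ_mulVec_W1_rel]

/-- Every block state is a unit vector, relative to `A` (Clifford+T with query gates is unitary).
[cite: NielsenChuang2010, §2.2.5] -/
theorem normSq_blockState_rel (ℓ : Fin (Lh P.toLayout x.length + 1)) :
    ∑ v, ‖((Cpad P x ℓ).toMatrix A *ᵥ basisState (W1 P x ∘ blockEmb P x ℓ)) v‖ ^ 2 = 1 := by
  have h := normSq_mulVec_of_mem_unitaryGroup
    (QCircuit.toMatrix_mem_unitaryGroup_holds cliffordT_isUnitary_holds A (Cpad P x ℓ)) (basisState (W1 P x ∘ blockEmb P x ℓ))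
  rw [normSq_basisState] at h
  exact h

/-! ### The kernel bound relative to an oracle -/

/-- **The kernel bound, relative to an oracle.** On input `x`, the wrapped family run with oracle
gates answered by `A` outputs a string with a prefix `g ⟨x, y⟩`, `y ∈ R (h x)`, with probability
at least the probability that the given family, run with the same oracle on `h x`, outputs a
string of `R (h x)` (the proof of `kernelProb_family_ge` with `A` for the empty oracle: after
stage 1 the register is `|w1 x⟩`; the quantum stage produces the product of the block states;
stage 2 permutes basis labels and writes `g ⟨x, live block⟩` to the front; the Born weight of the
target event dominates that of "the live block reads a string of `R (h x)`", which factors as the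
given family's kernel). [cite: BernsteinVazirani1997, §8 and §8.3 (classical computation inside oracle quantum machines)] -/
theorem kernelProb_family_ge_rel (R : List Bool → Set (List Bool)) :
    P.F.kernelProb A (P.h x) (R (P.h x)) ≤
      (family P).kernelProb A x {z | ∃ y ∈ R (P.h x), P.g (boolPair x y) <+: z} := by
  classical
  set T : Set (List Bool) := {z | ∃ y ∈ R (P.h x), P.g (boolPair x y) <+: z} with hT
  set φ : (ℓ : Fin (Lh P.toLayout x.length + 1)) → QReg (Pw P.toLayout x.length) → ℂ :=
    fun ℓ => (Cpad P x ℓ).toMatrix A *ᵥ basisState (W1 P x ∘ blockEmb P x ℓ) with hφdef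
  -- the wrapped family's kernel as a Born sum, pushed back along stage 2
  have hK : (family P).kernelProb A x T =
      ∑ z : QReg (x.length + anc P x.length), if List.ofFn (perm2 P x.length z) ∈ T then
        ‖prodState (blockEmb P x) φ (W1 P x) z‖ ^ 2 else 0 := by
    change ((((circ P x.length).outputPMF A x.get).map List.ofFn).toOuterMeasure T).toReal = _
    rw [toReal_outputPMF_map_ofFn, runOn_circ_rel]
    exact sum_ite_normSq_mulVec_of_perm (perm2 P x.length) (toMatrix_stage2_mulVec_basisState P A x.length) _ _
  -- the given family's kernel as a Born sum of the live block
  set U := (P.F.circ (P.h x).length).toMatrix A with hU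
  have hF : P.F.kernelProb A (P.h x) (R (P.h x)) =
      ∑ u : QReg ((P.h x).length + P.F.ancillas (P.h x).length), if List.ofFn u ∈ R (P.h x) then
        ‖U u (padInput (P.h x).get (P.F.ancillas (P.h x).length))‖ ^ 2 else 0 := by
    change ((((P.F.circ (P.h x).length).outputPMF A (P.h x).get).map List.ofFn).toOuterMeasure (R (P.h x))).toReal = _
    rw [toReal_outputPMF_map_ofFn]
    refine Finset.sum_congr rfl fun u _ => ?_
    rw [QCircuit.runOn, mulVec_basisState]
  -- the indicator of the live block event
  let G : QReg (Pw P.toLayout x.length) → ℝ := fun v => if List.ofFn (v ∘ Fin.castLEEmb (ls_fits (P := P) (x := x))) ∈ R (P.h x) then 1 else 0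
  -- (1) pointwise: on the support, the live block event implies the target event
  have h1 : ∀ z : QReg (x.length + anc P x.length),
      ‖prodState (blockEmb P x) φ (W1 P x) z‖ ^ 2 * G (z ∘ blockEmb P x lsFin) ≤
        (if List.ofFn (perm2 P x.length z) ∈ T then ‖prodState (blockEmb P x) φ (W1 P x) z‖ ^ 2 else 0) := by
    intro z
    by_cases hz : Agrees z
    · by_cases hG : List.ofFn ((z ∘ blockEmb P x lsFin) ∘ Fin.castLEEmb ls_fits) ∈ R (P.h x)
      · have hTz : List.ofFn (perm2 P x.length z) ∈ T := by
          refine ⟨_, hG, ?_⟩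
          rw [← out_eq hz]
          exact out_isPrefix_ofFn_perm2 hz
        simp only [G, hG, if_true, mul_one, hTz]
        exact le_rfl
      · simp only [G, hG, if_false, mul_zero]
        split_ifs <;> positivity
    · -- off the support the product state vanishes
      have h0 : prodState (blockEmb P x) φ (W1 P x) z = 0 := by
        have hz' : ¬ (∀ w, OffBlocks (blockEmb P x) w → z w = W1 P x w) := hz
        rw [prodState_apply, if_neg hz', zero_mul]
      simp [h0]
  -- (2) the left-hand side of (1), summed, is the given family's kernel
  have h2 : (∑ z : QReg (x.length + anc P x.length),
      ‖prodState (blockEmb P x) φ (W1 P x) z‖ ^ 2 * G (z ∘ blockEmb P x lsFin)) =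
        P.F.kernelProb A (P.h x) (R (P.h x)) := by
    rw [sum_normSq_prodState_mul (blockDisjoint P x) φ (W1 P x) (fun y => G (y lsFin)),
      sum_prod_mul_eq (fun ℓ v => ‖φ ℓ v‖ ^ 2) lsFin (fun ℓ _ => normSq_blockState_rel P x A ℓ) G, hF]
    -- the live block: padded copy on the padded input
    have hφ : ∀ v, ‖φ lsFin v‖ ^ 2 * G v =
        if List.ofFn (v ∘ Fin.castLEEmb (ls_fits (P := P) (x := x))) ∈ R (P.h x) then
          ‖(placeGate (Fin.castLEEmb ls_fits) U *ᵥ basisState (W1 P x ∘ blockEmb P x lsFin)) v‖ ^ 2 else 0 := by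
      intro v
      simp only [G, mul_ite, mul_one, mul_zero, hφdef, Cpad, toMatrix_mapWires, lsFin, hU]
    simp_rw [hφ]
    rw [sum_normSq_placeGate_castLE ls_fits U (W1 P x ∘ blockEmb P x lsFin)
      (fun u : QReg ((P.h x).length + P.F.ancillas (P.h x).length) => List.ofFn u ∈ R (P.h x))]
    refine Finset.sum_congr rfl fun u _ => ?_
    rw [W1_block_castLE]
  -- assemble
  rw [← h2, hK]
  exact Finset.sum_le_sum fun z _ => h1 z

end CWrap

/-! ### The relativized classical wrap -/

open _root_.Computability Complexity Cryptography

/-- **Classical wrapping inside uniform oracle circuit families (kernel form).** For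
polynomial-time string maps `h, g ∈ FP` and a poly-time uniform Clifford+T family `F`, possibly
with oracle gates, there is a poly-time uniform Clifford+T family `F'` (the wrapped family
`CWrap.family`: compute `h x` cleanly, route it by its length into the block of the matching copy
of `F`, run every copy, compute the wrapped post-processor cleanly and swap its output to the
front) such that, for EVERY oracle language `A`, every input `x` and every event `R`, `F'` run
with oracle `A` on `|x⟩|0…0⟩` outputs a string with a prefix `g ⟨x, y⟩`, `y ∈ R`, with
probability at least the probability that `F` run with oracle `A` on `|h x⟩|0…0⟩` outputs a
string of `R`. One family serves all oracles and all events.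
[cite: BernsteinVazirani1997, §8 and §8.3 (BQP^BQP = BQP; classical subroutines inside oracle quantum machines)] -/
theorem exists_uniform_classicalWrap_rel {h g : List Bool → List Bool} (hh : h ∈ FP) (hg : g ∈ FP)
    {F : QCircuitFamily cliffordT} (hU : F.IsUniform) :
    ∃ F' : QCircuitFamily cliffordT, F'.IsUniform ∧
      ∀ (A : Language Bool) (x : List Bool) (R : Set (List Bool)),
        F.kernelProb A (h x) R ≤ F'.kernelProb A x {z | ∃ y ∈ R, g (boolPair x y) <+: z} := by
  obtain ⟨P, rfl, rfl, rfl⟩ := CWrap.exists_params hh hg hU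
  exact ⟨CWrap.family P, CWrap.family_isUniform P hU, fun A x R =>
    CWrap.kernelProb_family_ge_rel P x A (fun _ => R)⟩

/-- **Search-problem reading: classical pre- and post-processing inside bounded-error quantum
search relative to an oracle** (the relativization of `isQSolvable_classicalWrap_holds` to
`IsQSolvableRel A`): if `h, g ∈ FP` and `R` is solvable with probability `≥ 2/3` by a uniform
family with query gates to `A`, then so is "on input `x`, output a string with prefix `g ⟨x, y⟩`
for some `y ∈ R (h x)`". [cite: BernsteinVazirani1997, §8 and §8.3] -/
theorem isQSolvableRel_classicalWrap (A : Language Bool) {h g : List Bool → List Bool} (hh : h ∈ FP) (hg : g ∈ FP)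
    {R : List Bool → Set (List Bool)} (hR : IsQSolvableRel A R) :
    IsQSolvableRel A fun x => {z | ∃ y ∈ R (h x), g (boolPair x y) <+: z} := by
  obtain ⟨F, hU, hF⟩ := hR
  obtain ⟨F', hU', hF'⟩ := exists_uniform_classicalWrap_rel hh hg hU
  exact ⟨F', hU', fun x => (hF (h x)).trans (hF' A x (R (h x)))⟩

end Literature.Computability.QuantumComplexity

end
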